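import Mathlib.MeasureTheory.Measure.Stieltjes
import Mathlib.MeasureTheory.Measure.Portmanteau
import Mathlib.MeasureTheory.Measure.ProbabilityMeasure
import Mathlib.MeasureTheory.Integral.IntervalIntegral.ContDiff
import Mathlib.MeasureTheory.Integral.DominatedConvergence
import Mathlib.Analysis.SpecialFunctions.Integrals.Basic
import HarnessLib

/-!
# Domination of a measure by a density from bounds on half-open intervals, and its stability
# under weak limits

Two elementary measure-theoretic lemmas on `(ℝ, Borel)`:

* `measure_le_withDensity_of_Ioc_le`: if a measure `μ` satisfies `μ((a, b]) ≤ ∫_a^b g` for all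
  `a < b`, with `g ≥ 0` continuous, then `μ ≤ g dx` on ALL Borel sets. (Inequalities do not
  propagate from a π-system in general; here they do because `g dx` is the Carathéodory extension
  of the interval function `(a, b] ↦ ∫_a^b g = G(b) - G(a)`, `G = ∫₀ˣ g` (`primitiveStieltjes`),
  i.e. an infimum over countable covers by half-open intervals — Mathlib's
  `StieltjesFunction.measure` and `OuterMeasure.le_ofFunction`.)
* `measure_Ioc_le_of_tendsto`: such interval bounds survive weak limits of probability measures:
  if `μₙ → μ` weakly and `μₙ((a, b]) ≤ ∫_a^b fₙ⁺ + εₙ` with `fₙ` continuous, uniformly bounded,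
  `fₙ → g` pointwise (`g` continuous) and `εₙ → 0`, then `μ((a, b]) ≤ ∫_a^b g⁺` (portmanteau for
  the open sets `(a, b + δ)`, dominated convergence on `[a, b + δ]`, and `δ → 0`).

## Purpose

In the thermodynamic limit of the Lieb–Wu (Bethe-ansatz) roots of the half-filled Hubbard chain
(Goldbaum, CMP 258 (2005) 317, §5), the ordering of the roots and the Lieb–Wu equations give the
COUNTING INEQUALITIES `#{j : k_j ∈ (a, b]}/N ≤ ∫_a^b (z_N')⁺ + 1/N` for the empirical measures; the
two lemmas of this file turn them into the domination `μ ≤ (z')⁺ dk` of every subsequential weak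
limit, which is the starting point of the identification step (movement 2) carried out in
`Literature.MathematicalPhysics.QuantumLattice` (see `LiebWuRootDensityLimit`).

## References

* P. Billingsley, *Convergence of Probability Measures*, 2nd ed. (1999), Theorem 2.1
  (portmanteau); Mathlib `ProbabilityMeasure.le_liminf_measure_open_of_tendsto`.
* Mathlib: `StieltjesFunction.measure`, `StieltjesFunction.length`, `OuterMeasure.le_ofFunction`,
  `Measure.ext_of_Ioc`, `intervalIntegral.tendsto_integral_filter_of_dominated_convergence`.
-/

noncomputable section


open MeasureTheory Set Filter Real
open scoped Topology ENNReal NNReal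

namespace Literature.MeasureTheory.Lebesgue

/-! ### From bounds on half-open intervals to domination by a density -/

/-- The primitive `x ↦ ∫₀ˣ g` of a nonnegative continuous function, as a Stieltjes function.
[folklore] -/
def primitiveStieltjes (g : ℝ → ℝ) (hg : Continuous g) (hg0 : ∀ x, 0 ≤ g x) : StieltjesFunction ℝ where
  toFun x := ∫ t in (0 : ℝ)..x, g t
  mono' a b hab := by
    show ∫ t in (0 : ℝ)..a, g t ≤ ∫ t in (0 : ℝ)..b, g t
    have h := intervalIntegral.integral_add_adjacent_intervals
      ((hg.intervalIntegrable (μ := volume) 0 a)) (hg.intervalIntegrable (μ := volume) a b)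
    have h0 : 0 ≤ ∫ t in a..b, g t := intervalIntegral.integral_nonneg hab fun t _ => hg0 t
    linarith
  right_continuous' x :=
    (intervalIntegral.continuous_primitive (fun a b => hg.intervalIntegrable a b) 0).continuousWithinAt

/-- Unfolding of `primitiveStieltjes`. [folklore] -/
theorem primitiveStieltjes_apply (g : ℝ → ℝ) (hg : Continuous g) (hg0 : ∀ x, 0 ≤ g x) (x : ℝ) :
    primitiveStieltjes g hg hg0 x = ∫ t in (0 : ℝ)..x, g t := rfl

/-- `G(b) - G(a) = ∫_a^b g` for the primitive `G`. [folklore] -/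
theorem primitiveStieltjes_sub (g : ℝ → ℝ) (hg : Continuous g) (hg0 : ∀ x, 0 ≤ g x) (a b : ℝ) :
    primitiveStieltjes g hg hg0 b - primitiveStieltjes g hg hg0 a = ∫ t in a..b, g t := by
  simp only [primitiveStieltjes_apply]
  have h := intervalIntegral.integral_add_adjacent_intervals
    ((hg.intervalIntegrable (μ := volume) 0 a)) (hg.intervalIntegrable (μ := volume) a b)
  linarith

/-- The Stieltjes measure of `x ↦ ∫₀ˣ g` is `g dx`. [folklore] -/
theorem primitiveStieltjes_measure (g : ℝ → ℝ) (hg : Continuous g) (hg0 : ∀ x, 0 ≤ g x) :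
    (primitiveStieltjes g hg hg0).measure = volume.withDensity fun x => ENNReal.ofReal (g x) := by
  refine Measure.ext_of_Ioc _ _ fun a b hab => ?_
  rw [StieltjesFunction.measure_Ioc, primitiveStieltjes_sub, withDensity_apply _ measurableSet_Ioc,
    intervalIntegral.integral_of_le hab.le,
    ofReal_integral_eq_lintegral_ofReal (hg.integrableOn_Icc.mono_set Ioc_subset_Icc_self)
      (Eventually.of_forall fun x => hg0 x)]

/-- **Domination from interval bounds.** If a measure `μ` on `ℝ` satisfies
`μ((a, b]) ≤ ∫_a^b g` for all `a < b`, with `g ≥ 0` continuous, then `μ ≤ g dx` as measures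
(Carathéodory: `g dx` is the Stieltjes outer measure of `∫₀ˣ g`, an infimum over covers by
half-open intervals). [folklore] -/
theorem measure_le_withDensity_of_Ioc_le {μ : Measure ℝ} {g : ℝ → ℝ} (hg : Continuous g)
    (hg0 : ∀ x, 0 ≤ g x)
    (h : ∀ a b, a < b → μ (Ioc a b) ≤ ENNReal.ofReal (∫ x in a..b, g x)) :
    μ ≤ volume.withDensity fun x => ENNReal.ofReal (g x) := by
  rw [← primitiveStieltjes_measure g hg hg0]
  set F := primitiveStieltjes g hg hg0 with hF
  rw [Measure.le_iff']
  intro s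
  rw [StieltjesFunction.measure]
  show μ s ≤ F.outer s
  change μ.toOuterMeasure s ≤ F.outer s
  revert s
  change μ.toOuterMeasure ≤ F.outer
  rw [StieltjesFunction.outer, OuterMeasure.le_ofFunction]
  intro s
  rw [StieltjesFunction.length_eq]
  simp only [le_iInf_iff]
  intro a b hs
  have hbot : (botSet : Set ℝ) = ∅ := by
    ext x
    simp only [botSet, mem_setOf_eq, mem_empty_iff_false, iff_false]
    exact not_isBot x
  rw [hbot, sdiff_empty] at hs
  rcases lt_or_ge a b with hab | hab
  · calc μ.toOuterMeasure s = μ s := rfl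
      _ ≤ μ (Ioc a b) := measure_mono hs
      _ ≤ ENNReal.ofReal (∫ x in a..b, g x) := h a b hab
      _ = ENNReal.ofReal (F b - F a) := by rw [hF, primitiveStieltjes_sub]
  · have : s = ∅ := by
      apply eq_empty_of_subset_empty
      rw [← Ioc_eq_empty_of_le hab]; exact hs
    simp [this]

/-! ### Passing interval bounds to a weak limit -/

/-- **Interval bounds survive weak limits.** Let probability measures `μₙ → μ` weakly on `ℝ`, and
suppose `μₙ((a, b]) ≤ ∫_a^b (fₙ)⁺ + εₙ` for all `a < b`, where the `fₙ` are continuous, uniformly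
bounded, and converge pointwise to a continuous `g`, and `εₙ → 0`. Then `μ((a, b]) ≤ ∫_a^b g⁺` for
all `a < b` (portmanteau for the open intervals `(a, b + δ)`, dominated convergence, `δ → 0`).
[folklore] -/
theorem measure_Ioc_le_of_tendsto {μs : ℕ → ProbabilityMeasure ℝ} {μ : ProbabilityMeasure ℝ}
    (hlim : Tendsto μs atTop (𝓝 μ)) {f : ℕ → ℝ → ℝ} {g : ℝ → ℝ} {B : ℝ}
    (hfB : ∀ n x, |f n x| ≤ B) (hfc : ∀ n, Continuous (f n)) (hgc : Continuous g)
    (hpt : ∀ x, Tendsto (fun n => f n x) atTop (𝓝 (g x)))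
    {ε : ℕ → ℝ} (hε : Tendsto ε atTop (𝓝 0))
    (hcount : ∀ n a b, a < b →
      ((μs n : Measure ℝ) (Ioc a b)) ≤ ENNReal.ofReal ((∫ x in a..b, max (f n x) 0) + ε n))
    {a b : ℝ} (hab : a < b) :
    (μ : Measure ℝ) (Ioc a b) ≤ ENNReal.ofReal (∫ x in a..b, max (g x) 0) := by
  have hB : 0 ≤ B := (abs_nonneg _).trans (hfB 0 0)
  -- it suffices to prove the bound on `(a, b + δ)` for every `δ > 0`
  have hδ : ∀ δ : ℝ, 0 < δ →
      (μ : Measure ℝ) (Ioc a b) ≤ ENNReal.ofReal ((∫ x in a..(b + δ), max (g x) 0)) := by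
    intro δ hδ
    have hopen : IsOpen (Ioo a (b + δ)) := isOpen_Ioo
    have h1 : (μ : Measure ℝ) (Ioc a b) ≤ (μ : Measure ℝ) (Ioo a (b + δ)) :=
      measure_mono fun x hx => ⟨hx.1, by linarith [hx.2]⟩
    have h2 := ProbabilityMeasure.le_liminf_measure_open_of_tendsto hlim hopen
    -- the upper bounds converge
    set c : ℕ → ℝ≥0∞ := fun n => ENNReal.ofReal ((∫ x in a..(b + δ), max (f n x) 0) + ε n) with hc
    have hab' : a < b + δ := by linarith
    have hcn : ∀ n, ((μs n : Measure ℝ) (Ioo a (b + δ))) ≤ c n := fun n =>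
      (measure_mono Ioo_subset_Ioc_self).trans (hcount n a (b + δ) hab')
    have hint : Tendsto (fun n => ∫ x in a..(b + δ), max (f n x) 0) atTop
        (𝓝 (∫ x in a..(b + δ), max (g x) 0)) := by
      refine intervalIntegral.tendsto_integral_filter_of_dominated_convergence (fun _ => B) ?_ ?_
        ?_ ?_
      · exact Eventually.of_forall fun n =>
          ((hfc n).max continuous_const).aestronglyMeasurable
      · refine Eventually.of_forall fun n => Eventually.of_forall fun x _ => ?_
        rw [Real.norm_eq_abs, abs_of_nonneg (le_max_right _ _)]
        exact max_le ((le_abs_self _).trans (hfB n x)) hB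
      · exact intervalIntegrable_const
      · exact Eventually.of_forall fun x _ => ((continuous_max.comp
          (continuous_id.prodMk continuous_const)).tendsto (g x)).comp (hpt x)
    have hc_lim : Tendsto c atTop (𝓝 (ENNReal.ofReal (∫ x in a..(b + δ), max (g x) 0))) := by
      simp only [hc]
      refine ENNReal.tendsto_ofReal ?_
      simpa using hint.add hε
    have h3 : atTop.liminf (fun n => ((μs n : Measure ℝ) (Ioo a (b + δ)))) ≤ atTop.liminf c :=
      liminf_le_liminf (Eventually.of_forall hcn)
    rw [hc_lim.liminf_eq] at h3
    exact h1.trans (h2.trans h3)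
  -- let `δ → 0`
  refine le_of_forall_pos_le_add fun η hη => ?_
  have hgB : ∀ x, max (g x) 0 ≤ B := fun x =>
    max_le (le_of_tendsto' ((hpt x)) fun n => (le_abs_self _).trans (hfB n x)) hB
  obtain ⟨δ, hδ0, hδB⟩ : ∃ δ : ℝ, 0 < δ ∧ (B * δ ≤ η.toReal ∨ η = ⊤) := by
    rcases eq_or_ne η ⊤ with h | h
    · exact ⟨1, one_pos, Or.inr h⟩
    · have hη' : 0 < η.toReal := ENNReal.toReal_pos hη.ne' h
      refine ⟨η.toReal / (B + 1), by positivity, Or.inl ?_⟩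
      rw [mul_div_assoc']
      rw [div_le_iff₀ (by positivity)]
      nlinarith
  rcases hδB with hδB | rfl
  · refine (hδ δ hδ0).trans ?_
    have hsplit : ∫ x in a..(b + δ), max (g x) 0 =
        (∫ x in a..b, max (g x) 0) + ∫ x in b..(b + δ), max (g x) 0 :=
      (intervalIntegral.integral_add_adjacent_intervals
        ((hgc.max continuous_const).intervalIntegrable (μ := volume) _ _)
        ((hgc.max continuous_const).intervalIntegrable (μ := volume) _ _)).symm
    have htail : ∫ x in b..(b + δ), max (g x) 0 ≤ B * δ := by
      have h1 := intervalIntegral.integral_mono_on (μ := volume) (a := b) (b := b + δ)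
        (f := fun x => max (g x) 0) (g := fun _ => B) (by linarith)
        ((hgc.max continuous_const).intervalIntegrable (μ := volume) _ _) intervalIntegrable_const
        (fun x _ => hgB x)
      rw [intervalIntegral.integral_const, smul_eq_mul] at h1
      have h2 : (b + δ - b) * B = B * δ := by ring
      linarith
    have h0 : 0 ≤ ∫ x in a..b, max (g x) 0 :=
      intervalIntegral.integral_nonneg hab.le fun x _ => le_max_right _ _
    have htail0 : 0 ≤ ∫ x in b..(b + δ), max (g x) 0 :=
      intervalIntegral.integral_nonneg (by linarith) fun x _ => le_max_right _ _
    rw [hsplit, ENNReal.ofReal_add h0 htail0]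
    gcongr
    calc ENNReal.ofReal (∫ x in b..(b + δ), max (g x) 0) ≤ ENNReal.ofReal (B * δ) :=
          ENNReal.ofReal_le_ofReal htail
      _ ≤ ENNReal.ofReal η.toReal := ENNReal.ofReal_le_ofReal hδB
      _ ≤ η := ENNReal.ofReal_toReal_le
  · simp

end Literature.MeasureTheory.Lebesgue
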